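import Summits.CriticalPhenomena.PercolationContinuityZ3.Theorems.PercNearOneGluingNoHeavyPcintThirdMemStep
import HarnessLib

/-!
# PCINT lane, reduction B3t on the memory-`τ` DANGEROUS-SET automaton — the on-path charges are events

Cell `prim-pcint` (PAPER-2 track (iii): certified intervals for `p_c(ℤ^d)`), seat `prim-pcint-2` (gen 4); support file
(`--supports stmt-CriticalPhenomena-4575`).  Does NOT build on p205010.  Memo: `run/shared/lean/prim/pcint/REDUCTIONS.md` §B3t.

Continuation of `…ThirdMemStep`: the CHARGE `chargeF` of the automaton at an absolute on-path site (det-paying factor `siteF`, plus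
`s²` at a claimed corner site), and **`prod_chargeF_le_onF`**: the charges at the on-path events of a step, indexed by `onEventsR`,
multiply to at most the on-path factor `onF` of the step.
-/

noncomputable section

namespace Summit.CriticalPhenomena.PercolationContinuityZ3.Theorems.Pcint

open Finset Literature.Probability.Percolation Literature.Probability.LatticeModels ChainBond

variable {d : ℕ} (a₀ : Fin d × Bool) {τ kc n : ℕ} {γ : Fin n → Fin d × Bool}

section Step

open Classical

variable {s tv κb : ℝ}

/-! ### On the path: the charges of the events -/

/-- The CHARGE of the automaton at the absolute site `x` at step `t`: the site factor if `x - v_t` is det-paying, and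
`s²` if `x` is the claimed corner site (a budget below `κ̄`). [folklore] -/
def chargeF (s tv : ℝ) (τ kc : ℕ) (γ : Fin n → Fin d × Bool) (t : ℕ) (x : Site d) : ℝ :=
  if ht : t < n then
    (if x - wordPos γ t ∈ cdetSet kc (danger τ (pre a₀ γ t)) (γ ⟨t, ht⟩) then
        siteF s tv τ kc (danger τ (pre a₀ γ t)) (γ ⟨t, ht⟩) (x - wordPos γ t) else 1) *
      (if bcorner (danger τ (pre a₀ γ t)) (γ ⟨t, ht⟩) = true ∧ cornerSite γ (t - 1) = x then s ^ 2 else 1)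
  else 1

/-- Charges are nonnegative. [folklore] -/
theorem chargeF_nonneg (hs0 : 0 ≤ s) (ht0 : 0 ≤ tv) (t : ℕ) (x : Site d) : 0 ≤ chargeF a₀ s tv τ kc γ t x := by
  unfold chargeF siteF; split_ifs <;> positivity

/-- Charges are at most one. [folklore] -/
theorem chargeF_le_one (hs0 : 0 ≤ s) (hs1 : s ≤ 1) (ht0 : 0 ≤ tv) (hts : tv ≤ s) (t : ℕ) (x : Site d) :
    chargeF a₀ s tv τ kc γ t x ≤ 1 := by
  unfold chargeF siteF
  have h1 : tv ≤ 1 := hts.trans hs1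
  split_ifs
  · exact mul_le_one₀ (mul_le_one₀ (pow_le_one₀ hs0 hs1) (pow_nonneg ht0 _) (pow_le_one₀ ht0 h1)) (by positivity)
      (by nlinarith)
  · rw [mul_one]; exact mul_le_one₀ (pow_le_one₀ hs0 hs1) (pow_nonneg ht0 _) (pow_le_one₀ ht0 h1)
  · rw [one_mul]; nlinarith
  · simp
  · simp

/-- **On-path charges are events**: `∏_{fibre t of onEventsR} chargeF t (v_h) ≤ onF t` (`s² ≤ κ̄`). [folklore] -/
theorem prod_chargeF_le_onF (hτ : 2 ≤ τ) {t : ℕ} (ht : t < n) (hs0 : 0 ≤ s) (hs1 : s ≤ 1) (ht0 : 0 ≤ tv)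
    (hts : tv ≤ s) (hκb : s ^ 2 ≤ κb) :
    ∏ th ∈ (onEventsR τ γ).filter (fun th => th.1 = t), chargeF a₀ s tv τ kc γ t (wordPos γ th.2) ≤
      onF a₀ s tv κb τ kc γ t := by
  set S := danger τ (pre a₀ γ t) with hS
  set a := γ ⟨t, ht⟩ with ha
  set E := (onEventsR τ γ).filter (fun th => th.1 = t) with hE
  set Don := (cdetSet kc S a).filter fun w' => w' + wordPos γ t ∈ pathSites γ with hDon
  have hκ0 : 0 ≤ κb := le_trans (sq_nonneg s) hκb
  -- the map `w' ↦ (t, pathIdx (w' + v_t))` sends `Don` into the fibre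
  have hDonE : ∀ w' ∈ Don, (t, pathIdx γ (w' + wordPos γ t)) ∈ E ∧ wordPos γ (pathIdx γ (w' + wordPos γ t)) = w' + wordPos γ t := by
    intro w' hw'
    obtain ⟨hD, hon⟩ := mem_filter.1 hw'
    obtain ⟨hle, hpos⟩ := pathIdx_spec γ hon
    have hD' := hD
    rw [cdetSet, mem_filter, mem_nbrSites] at hD'
    obtain ⟨hadj', hw0, hnotin, ⟨q, hq, -⟩, -⟩ := hD'
    obtain ⟨hqS, hqw⟩ := mem_bcinc.1 hq
    obtain ⟨hqle, hrem, hq1⟩ := isRem_of_mem_danger_pre a₀ ht.le hqS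
    refine ⟨mem_filter.2 ⟨mem_onEventsR.2 ⟨ht, hle, ?_, ?_, ?_, ?_, t - q.2, by have := hrem.1; omega, hrem, ?_⟩, rfl⟩,
      hpos⟩
    · intro hh
      have : w' + wordPos γ t = wordPos γ t := hpos.symm.trans (congrArg (wordPos γ) hh)
      exact hw0 (by simpa using this)
    · intro hh
      have hx : w' + wordPos γ t = wordPos γ (t + 1) := hpos.symm.trans (congrArg (wordPos γ) hh)
      have hadj : (zdGraph d).Adj (wordPos γ (t + 1)) (w' + wordPos γ t) := by
        rw [← adj_sub_wordPos_iff γ t, ← stepVec_eq_sub ht, add_sub_cancel_right]; exact hadj'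
      rw [hx] at hadj; exact hadj.ne rfl
    · intro hrem'
      have hmem := mem_danger_pre_of_isRem a₀ ht.le hrem'
      exact hnotin _ hmem (by simp only [hpos, add_sub_cancel_right])
    · rw [hpos, ← adj_sub_wordPos_iff γ t, ← stepVec_eq_sub ht, add_sub_cancel_right]; exact hadj'.symm
    · rw [hpos, ← adj_sub_wordPos_iff γ t, ← hq1, add_sub_cancel_right]; exact hqw
  have hinj : Set.InjOn (fun w' => (t, pathIdx γ (w' + wordPos γ t))) ↑Don := by
    intro x hx y hy hxy
    have hx' := (hDonE x (mem_coe.1 hx)).2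
    have hy' := (hDonE y (mem_coe.1 hy)).2
    have := (Prod.mk.inj hxy).2
    have e : x + wordPos γ t = y + wordPos γ t := by rw [← hx', ← hy', this]
    exact add_right_cancel e
  set Im := Don.image fun w' => (t, pathIdx γ (w' + wordPos γ t)) with hIm
  have hImsub : Im ⊆ E := by
    intro th hth
    obtain ⟨w', hw', rfl⟩ := mem_image.1 hth
    exact (hDonE w' hw').1
  -- split the charges into the det part and the corner part
  have hsplit : ∀ th ∈ E, chargeF a₀ s tv τ kc γ t (wordPos γ th.2) =
      (if wordPos γ th.2 - wordPos γ t ∈ cdetSet kc S a then siteF s tv τ kc S a (wordPos γ th.2 - wordPos γ t) else 1) *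
        (if bcorner S a = true ∧ cornerSite γ (t - 1) = wordPos γ th.2 then s ^ 2 else 1) := by
    intro th _; rw [chargeF, dif_pos ht]
  rw [prod_congr rfl hsplit, prod_mul_distrib, onF, dif_pos ht]
  have hsF1 : ∀ w', siteF s tv τ kc S a w' ≤ 1 := fun w' => by
    unfold siteF
    exact mul_le_one₀ (pow_le_one₀ hs0 hs1) (pow_nonneg ht0 _) (pow_le_one₀ ht0 (hts.trans hs1))
  have hsF0 : ∀ w', 0 ≤ siteF s tv τ kc S a w' := fun w' => by unfold siteF; positivity
  -- det part
  have hdet : ∏ th ∈ E, (if wordPos γ th.2 - wordPos γ t ∈ cdetSet kc S a then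
      siteF s tv τ kc S a (wordPos γ th.2 - wordPos γ t) else 1) ≤ ∏ w' ∈ Don, siteF s tv τ kc S a w' := by
    rw [← prod_sdiff hImsub]
    have h1 : ∏ th ∈ E \ Im, (if wordPos γ th.2 - wordPos γ t ∈ cdetSet kc S a then
        siteF s tv τ kc S a (wordPos γ th.2 - wordPos γ t) else 1) ≤ 1 :=
      prod_le_one (fun th _ => by split_ifs <;> [exact hsF0 _; exact zero_le_one])
        fun th _ => by split_ifs <;> [exact hsF1 _; exact le_rfl]
    have h2 : ∏ th ∈ Im, (if wordPos γ th.2 - wordPos γ t ∈ cdetSet kc S a then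
        siteF s tv τ kc S a (wordPos γ th.2 - wordPos γ t) else 1) = ∏ w' ∈ Don, siteF s tv τ kc S a w' := by
      rw [hIm, prod_image hinj]
      refine prod_congr rfl fun w' hw' => ?_
      have hpos := (hDonE w' hw').2
      simp only [hpos, add_sub_cancel_right]
      rw [if_pos (mem_filter.1 hw').1]
    have h20 : 0 ≤ ∏ th ∈ Im, (if wordPos γ th.2 - wordPos γ t ∈ cdetSet kc S a then
        siteF s tv τ kc S a (wordPos γ th.2 - wordPos γ t) else 1) :=
      prod_nonneg fun th _ => by split_ifs <;> [exact hsF0 _; exact zero_le_one]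
    calc _ ≤ 1 * ∏ th ∈ Im, (if wordPos γ th.2 - wordPos γ t ∈ cdetSet kc S a then
          siteF s tv τ kc S a (wordPos γ th.2 - wordPos γ t) else 1) := mul_le_mul_of_nonneg_right h1 h20
      _ = _ := by rw [one_mul, h2]
  -- corner part
  have hcor : ∏ th ∈ E, (if bcorner S a = true ∧ cornerSite γ (t - 1) = wordPos γ th.2 then s ^ 2 else (1 : ℝ)) ≤
      (if bcorner S a = true ∧ cornerSite γ (t - 1) ∈ pathSites γ then κb else 1) := by
    by_cases hcase : bcorner S a = true ∧ cornerSite γ (t - 1) ∈ pathSites γ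
    · rw [if_pos hcase]
      obtain ⟨hc, honc⟩ := hcase
      -- the corner event `(t, pathIdx C)` is in the fibre and carries the factor `s²`
      obtain ⟨ht1, -, hCdef, hC1, hC2, hCne, hnot, -⟩ := bcorner_spec a₀ ht hc
      obtain ⟨hleC, hposC⟩ := pathIdx_spec γ honc
      have hthCE : (t, pathIdx γ (cornerSite γ (t - 1))) ∈ E := by
        refine mem_filter.2 ⟨mem_onEventsR.2 ⟨ht, hleC, ?_, ?_, ?_, ?_, t - 1, by omega, ⟨by omega, by omega, ?_⟩, ?_⟩, rfl⟩
        · show pathIdx γ (cornerSite γ (t - 1)) ≠ t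
          intro hh; exact hCne (hposC.symm.trans (congrArg (wordPos γ) hh))
        · show pathIdx γ (cornerSite γ (t - 1)) ≠ t + 1
          intro hh
          have hx : cornerSite γ (t - 1) = wordPos γ (t + 1) := hposC.symm.trans (congrArg (wordPos γ) hh)
          rw [hx] at hC1; exact hC1.ne rfl
        · show ¬ IsRem τ γ (pathIdx γ (cornerSite γ (t - 1))) t
          intro hrem
          have hmem := mem_danger_pre_of_isRem a₀ ht.le hrem
          exact hnot _ hmem (by rw [hposC])
        · show (zdGraph d).Adj (wordPos γ (pathIdx γ (cornerSite γ (t - 1)))) (wordPos γ (t + 1))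
          rw [hposC]; exact hC1.symm
        · have hprev : wordPos γ t = wordPos γ (t - 1) + stepVec (γ ⟨t - 1, by omega⟩) := by
            conv_lhs => rw [show t = t - 1 + 1 by omega]
            exact wordPos_succ γ (by omega)
          rw [show wordPos γ (t - 1) - wordPos γ t = -stepVec (γ ⟨t - 1, by omega⟩) by rw [hprev]; abel, l1_neg,
            l1_stepVec]
          omega
        · show (zdGraph d).Adj (wordPos γ (t - 1)) (wordPos γ (pathIdx γ (cornerSite γ (t - 1))))
          rw [hposC]; exact hC2
      have hfacC : (if bcorner S a = true ∧ cornerSite γ (t - 1) = wordPos γ (t, pathIdx γ (cornerSite γ (t - 1))).2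
          then s ^ 2 else (1 : ℝ)) = s ^ 2 := by
        rw [if_pos ⟨hc, hposC.symm⟩]
      rw [← mul_prod_erase E _ hthCE, hfacC]
      calc s ^ 2 * ∏ th ∈ E.erase (t, pathIdx γ (cornerSite γ (t - 1))), (if bcorner S a = true ∧ cornerSite γ (t - 1) = wordPos γ th.2 then s ^ 2 else (1 : ℝ))
          ≤ s ^ 2 * 1 := mul_le_mul_of_nonneg_left
            (prod_le_one (fun th _ => by split_ifs <;> positivity) fun th _ => by split_ifs <;> nlinarith) (sq_nonneg s)
        _ ≤ κb := by rw [mul_one]; exact hκb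
    · rw [if_neg hcase]
      refine le_of_eq (prod_eq_one fun th hth => ?_)
      rw [if_neg]
      rintro ⟨hc, hC⟩
      apply hcase
      refine ⟨hc, ?_⟩
      have hle := (mem_onEventsR.1 (mem_filter.1 hth).1).2.1
      rw [hC]
      exact mem_pathSites.2 ⟨th.2, hle, rfl⟩
  have hdet0 : 0 ≤ ∏ th ∈ E, (if wordPos γ th.2 - wordPos γ t ∈ cdetSet kc S a then
      siteF s tv τ kc S a (wordPos γ th.2 - wordPos γ t) else 1) :=
    prod_nonneg fun th _ => by split_ifs <;> [exact hsF0 _; exact zero_le_one]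
  exact mul_le_mul hdet hcor (prod_nonneg fun th _ => by split_ifs <;> positivity) (prod_nonneg fun _ _ => hsF0 _)

end Step

end Summit.CriticalPhenomena.PercolationContinuityZ3.Theorems.Pcint
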